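import Summits.Ventures.Crystal3D.Theorems.StickyWulffConstantCoaxialWallLawChainTorsionTwin
import Summits.Ventures.Crystal3D.Theorems.StickyWulffConstantGenericWallFloorAtHalfWide
import HarnessLib

/-!
# WIDE tilt: the level-⅓ freeness with slots of `e₃`-component `≥ 9/20` (crux `CoaxialWallLaw`, stmt-Ventures-19481,
# line `WallLedgerF`)

HONEST FRAMING. Venture `Summits/Ventures/Crystal3D` (cell `crystal3d-full`), helper `--supports` the crux `CoaxialWallLaw`
of `route-Ventures-StickyWulffConstant` (REGISTERED line `WallLedgerF`, open stub `stub_coaxialTwoSlabAdhesion`).  Rung credit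
only; F-C1 not moved; NOT the stub; `ExactOnly`(C12-55) [E1] and `StarPairFar` stay BY NAME.

`…ChainTorsionLedger` / `…ChainTorsionTwin` asked the slot `u₁` to be STEEP for the cell vertical (`⟪A₁u₁, e₃⟫ ≥ √2/2`).  The
one-sided positional ledger (`twoSlabAdhesion_stackLedger_oneSided_reach`) runs with any TILTED walker vertical `z`,
`‖z − e₃‖ ≤ 1/3`, and the chain-torsion theorems hold for every `z`; with 19480-p1's `exists_tilt_vertical_wide` every slot with
`⟪A₁u₁, e₃⟫ ≥ 9/20` is steep for some admissible `z`.  Hence: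
* `twoSlabLedgerAt_oneSided_reach_wide` — the packaged one-sided ledger for a tilted vertical;
* **`twoSlabLedgerAt_oneSided_of_level_third_wide`** — translation OR twin-about-`n₁` pair, offset of level ⅓ outside the two
  fault cosets of the planes through a slot `u₁` with `⟪A₁u₁, e₃⟫ ≥ 9/20` ⇒ `TwoSlabLedgerAt ((√2/2)⟪A₁u₁,e₃⟫)` (charge
  `≥ 0.318`), ARBITRARY fillings, modulo E1/StarPairFar;
* **`coaxialTwoSlabAdhesion_of_level_third_wide`** — the stub's conclusion VERBATIM whenever that charge dominates lane F's
  `½·√(1 − ⟪L e₃, e₃⟫²)` for the given co-axial frame `L` (automatic for steep slots; for `{110}`-vicinal walls with the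
  nearest axis: `0.354 ≥ 0.289`).
READING.  With the wide tilt a `{110}`-vicinal wall has FIVE qualifying slots whose coset conditions `y₁≡y₂`, `y₁≡±y₃`,
`y₂≡±y₃ (mod 3)` intersect in the TRIVIAL class: there NO level-⅓ translation class is registered at all.
WHAT THIS IS NOT: not the stub; F-C1 not moved.
-/

noncomputable section

namespace Summit.Ventures.Crystal3D.Theorems

open Summit.Ventures.Crystal3D Finset
open Literature.MathematicalPhysics.StatisticalMechanics (fccStacking barlowStacking IsHaggSeq contactDeficiency)
open scoped InnerProductSpace

open scoped Classical in
/-- **Packaged one-sided ledger, tilted vertical**: `z` unit with `‖z − e₃‖ ≤ 1/3`, `u₁` steep for `z`, grain 1's reach set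
over `chainFrames z A₁ u₁` missing the far affine lattice ⇒ `TwoSlabLedgerAt (½κ₁)`; modulo E1/StarPairFar. -/
theorem twoSlabLedgerAt_oneSided_reach_wide
    {s₀ : EuclideanSpace ℝ (Fin 3)} (hs₀ : s₀ ∈ fccSlots)
    (hcert : ExactOnly 0 (fccSlots.filter fun w => 0 < ⟪w, s₀⟫_ℝ)) (hSP : StarPairFar)
    (A₁ : EuclideanSpace ℝ (Fin 3) ≃ₗᵢ[ℝ] EuclideanSpace ℝ (Fin 3)) (t₁ : EuclideanSpace ℝ (Fin 3))
    (A₂ : EuclideanSpace ℝ (Fin 3) ≃ₗᵢ[ℝ] EuclideanSpace ℝ (Fin 3)) (t₂ : EuclideanSpace ℝ (Fin 3))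
    {z : EuclideanSpace ℝ (Fin 3)} (hz : ‖z‖ = 1) (hze : ‖z - EuclideanSpace.single (2 : Fin 3) (1 : ℝ)‖ ≤ 1 / 3)
    {u₁ : EuclideanSpace ℝ (Fin 3)} (hu₁ : u₁ ∈ fccSlots) (hsteep₁ : Real.sqrt 2 / 2 ≤ ⟪A₁ u₁, z⟫_ℝ)
    (hoff : ∀ y ∈ reachSet A₁ t₁ (chainFrames z A₁ u₁), y ∉ (fun q => A₂ q + t₂) '' fccStacking 1 (Real.sqrt (2 / 3))) :
    TwoSlabLedgerAt (Real.sqrt 2 * |⟪A₁ u₁, EuclideanSpace.single (2 : Fin 3) (1 : ℝ)⟫_ℝ| / 2) A₁ t₁ A₂ t₂ :=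
  twoSlabAdhesion_stackLedger_oneSided_reach hs₀ hcert (doubleStarCoaxialAt_of_starPairFar hSP)
    (capPairCoaxial_of_starPairFar hSP) A₁ t₁ A₂ t₂ hz hze hu₁ hsteep₁ _
    (fun _ hS hW hlast => frame_mem_chainFrames_of_stack hS hW hlast) hoff

open scoped Classical in
/-- **Level-⅓ pairs outside the two cosets, WIDE tilt**: translation or twin-about-`n₁` pair, slot `u₁` with
`⟪A₁u₁, e₃⟫ ≥ 9/20`, `n₁ ∋ u₁` ⇒ `TwoSlabLedgerAt ((√2/2)⟪A₁u₁, e₃⟫)`, ARBITRARY fillings, modulo E1/StarPairFar. -/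
theorem twoSlabLedgerAt_oneSided_of_level_third_wide
    {s₀ : EuclideanSpace ℝ (Fin 3)} (hs₀ : s₀ ∈ fccSlots)
    (hcert : ExactOnly 0 (fccSlots.filter fun w => 0 < ⟪w, s₀⟫_ℝ)) (hSP : StarPairFar)
    (A₁ : EuclideanSpace ℝ (Fin 3) ≃ₗᵢ[ℝ] EuclideanSpace ℝ (Fin 3)) (t₁ : EuclideanSpace ℝ (Fin 3))
    (A₂ : EuclideanSpace ℝ (Fin 3) ≃ₗᵢ[ℝ] EuclideanSpace ℝ (Fin 3)) (t₂ : EuclideanSpace ℝ (Fin 3))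
    {u₁ n₁ : EuclideanSpace ℝ (Fin 3)} (hu₁ : u₁ ∈ fccSlots)
    (hup : (9 / 20 : ℝ) ≤ ⟪A₁ u₁, EuclideanSpace.single (2 : Fin 3) (1 : ℝ)⟫_ℝ) (hn₁ : ‖n₁‖ = 1)
    (hmenu₁ : ∀ w ∈ fccSlots, ⟪A₁ w, n₁⟫_ℝ = 0 ∨ ⟪A₁ w, n₁⟫_ℝ = Real.sqrt (2 / 3) ∨ ⟪A₁ w, n₁⟫_ℝ = -Real.sqrt (2 / 3))
    (hun : ⟪A₁ u₁, n₁⟫_ℝ = Real.sqrt (2 / 3))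
    (hΛ : A₂ '' fccStacking 1 (Real.sqrt (2 / 3)) = A₁ '' fccStacking 1 (Real.sqrt (2 / 3)) ∨
      A₂ '' fccStacking 1 (Real.sqrt (2 / 3)) = twinFrame A₁ n₁ '' fccStacking 1 (Real.sqrt (2 / 3)))
    (h3 : A₁.symm ((3 : ℝ) • (t₂ - t₁)) ∈ fccStacking 1 (Real.sqrt (2 / 3)))
    (hnot : ∀ a b : ℤ, A₁.symm (t₂ - t₁ - (a : ℝ) • (Real.sqrt (2 / 3) • n₁) -
      (b : ℝ) • (Real.sqrt (2 / 3) • ((2 * Real.sqrt (2 / 3)) • A₁ u₁ - n₁))) ∉ fccStacking 1 (Real.sqrt (2 / 3))) :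
    TwoSlabLedgerAt (Real.sqrt 2 * ⟪A₁ u₁, EuclideanSpace.single (2 : Fin 3) (1 : ℝ)⟫_ℝ / 2) A₁ t₁ A₂ t₂ := by
  obtain ⟨z, hz, hze, hsteep⟩ := exists_tilt_vertical_wide
    (by rw [LinearIsometryEquiv.norm_map, norm_eq_one_of_mem_fccSlots hu₁]) hup
  have hoff : ∀ y ∈ reachSet A₁ t₁ (chainFrames z A₁ u₁), y ∉ (fun q => A₂ q + t₂) '' fccStacking 1 (Real.sqrt (2 / 3)) := by
    rcases hΛ with hΛ | hΛ
    · exact oneSided_offReach_of_level_third z A₁ t₁ A₂ t₂ hΛ hu₁ hn₁ hmenu₁ hun h3 hnot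
    · exact oneSided_offReach_of_level_third_twin z A₁ t₁ A₂ t₂ hu₁ hn₁ hmenu₁ hun hΛ h3 hnot
  have h := twoSlabLedgerAt_oneSided_reach_wide hs₀ hcert hSP A₁ t₁ A₂ t₂ hz hze hu₁ hsteep hoff
  rwa [abs_of_nonneg (by linarith : (0 : ℝ) ≤ ⟪A₁ u₁, EuclideanSpace.single (2 : Fin 3) (1 : ℝ)⟫_ℝ)] at h

open scoped Classical in
/-- **Lane F's stub conclusion VERBATIM, wide tilt**, for the given co-axial frame `L` whenever the one-sided charge
`(√2/2)⟪A₁u₁, e₃⟫` dominates `½·√(1 − ⟪L e₃, e₃⟫²)`; ARBITRARY fillings, modulo E1/StarPairFar. -/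
theorem coaxialTwoSlabAdhesion_of_level_third_wide
    {s₀ : EuclideanSpace ℝ (Fin 3)} (hs₀ : s₀ ∈ fccSlots)
    (hcert : ExactOnly 0 (fccSlots.filter fun w => 0 < ⟪w, s₀⟫_ℝ)) (hSP : StarPairFar)
    (A₁ : EuclideanSpace ℝ (Fin 3) ≃ₗᵢ[ℝ] EuclideanSpace ℝ (Fin 3)) (t₁ : EuclideanSpace ℝ (Fin 3))
    (A₂ : EuclideanSpace ℝ (Fin 3) ≃ₗᵢ[ℝ] EuclideanSpace ℝ (Fin 3)) (t₂ : EuclideanSpace ℝ (Fin 3))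
    (L : EuclideanSpace ℝ (Fin 3) ≃ₗᵢ[ℝ] EuclideanSpace ℝ (Fin 3)) (s₁ s₂ : EuclideanSpace ℝ (Fin 3)) {σ σ' : ℤ → ℤ}
    (hσ : IsHaggSeq σ) (hσ' : IsHaggSeq σ')
    (hsub₁ : (fun p => A₁ p + t₁) '' fccStacking 1 (Real.sqrt (2 / 3)) ⊆
      (fun p => L p + s₁) '' barlowStacking 1 (Real.sqrt (2 / 3)) σ)
    (hsub₂ : (fun p => A₂ p + t₂) '' fccStacking 1 (Real.sqrt (2 / 3)) ⊆
      (fun p => L p + s₂) '' barlowStacking 1 (Real.sqrt (2 / 3)) σ')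
    {u₁ n₁ : EuclideanSpace ℝ (Fin 3)} (hu₁ : u₁ ∈ fccSlots)
    (hup : (9 / 20 : ℝ) ≤ ⟪A₁ u₁, EuclideanSpace.single (2 : Fin 3) (1 : ℝ)⟫_ℝ) (hn₁ : ‖n₁‖ = 1)
    (hmenu₁ : ∀ w ∈ fccSlots, ⟪A₁ w, n₁⟫_ℝ = 0 ∨ ⟪A₁ w, n₁⟫_ℝ = Real.sqrt (2 / 3) ∨ ⟪A₁ w, n₁⟫_ℝ = -Real.sqrt (2 / 3))
    (hun : ⟪A₁ u₁, n₁⟫_ℝ = Real.sqrt (2 / 3))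
    (hΛ : A₂ '' fccStacking 1 (Real.sqrt (2 / 3)) = A₁ '' fccStacking 1 (Real.sqrt (2 / 3)) ∨
      A₂ '' fccStacking 1 (Real.sqrt (2 / 3)) = twinFrame A₁ n₁ '' fccStacking 1 (Real.sqrt (2 / 3)))
    (h3 : A₁.symm ((3 : ℝ) • (t₂ - t₁)) ∈ fccStacking 1 (Real.sqrt (2 / 3)))
    (hnot : ∀ a b : ℤ, A₁.symm (t₂ - t₁ - (a : ℝ) • (Real.sqrt (2 / 3) • n₁) -
      (b : ℝ) • (Real.sqrt (2 / 3) • ((2 * Real.sqrt (2 / 3)) • A₁ u₁ - n₁))) ∉ fccStacking 1 (Real.sqrt (2 / 3)))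
    (hcmp : (1 / 2 : ℝ) * Real.sqrt (1 - ⟪L (EuclideanSpace.single (2 : Fin 3) (1 : ℝ)),
      (EuclideanSpace.single (2 : Fin 3) (1 : ℝ))⟫_ℝ ^ 2) ≤ Real.sqrt 2 * ⟪A₁ u₁, EuclideanSpace.single (2 : Fin 3) (1 : ℝ)⟫_ℝ / 2) :
    ∃ (L : EuclideanSpace ℝ (Fin 3) ≃ₗᵢ[ℝ] EuclideanSpace ℝ (Fin 3))
        (s₁ s₂ : EuclideanSpace ℝ (Fin 3)) (σ σ' : ℤ → ℤ), IsHaggSeq σ ∧ IsHaggSeq σ' ∧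
        (fun p => A₁ p + t₁) '' fccStacking 1 (Real.sqrt (2 / 3)) ⊆
          (fun p => L p + s₁) '' barlowStacking 1 (Real.sqrt (2 / 3)) σ ∧
        (fun p => A₂ p + t₂) '' fccStacking 1 (Real.sqrt (2 / 3)) ⊆
          (fun p => L p + s₂) '' barlowStacking 1 (Real.sqrt (2 / 3)) σ' ∧
    ∃ C R₀ : ℝ, 1 ≤ R₀ ∧ ∀ h : ℝ, 0 ≤ h → ∀ ρ : ℝ, R₀ ≤ ρ →
      ∀ X P₁ P₂ : Finset (EuclideanSpace ℝ (Fin 3)),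
      (∀ p ∈ X, ∀ q ∈ X, p ≠ q → 1 ≤ dist p q) → P₁ ⊆ X → P₂ ⊆ X \ P₁ →
      (∀ p ∈ X, -(2 * R₀) ≤ p 2 ∧ p 2 ≤ h + 2 * R₀ ∧ p 0 ^ 2 + p 1 ^ 2 ≤ ρ ^ 2) →
      (∀ p, p ∈ P₁ ↔ (p ∈ (fun q => A₁ q + t₁) '' fccStacking 1 (Real.sqrt (2 / 3)) ∧
        -(2 * R₀) ≤ p 2 ∧ p 2 ≤ -R₀ ∧ p 0 ^ 2 + p 1 ^ 2 ≤ ρ ^ 2)) →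
      (∀ p, p ∈ P₂ ↔ (p ∈ (fun q => A₂ q + t₂) '' fccStacking 1 (Real.sqrt (2 / 3)) ∧
        h + R₀ ≤ p 2 ∧ p 2 ≤ h + 2 * R₀ ∧ p 0 ^ 2 + p 1 ^ 2 ≤ ρ ^ 2)) →
      ((((P₁ ×ˢ (X \ P₁)).filter fun pq => dist pq.1 pq.2 = 1).card : ℕ) : ℝ) +
        ((((P₂ ×ˢ ((X \ P₁) \ P₂)).filter fun pq => dist pq.1 pq.2 = 1).card : ℕ) : ℝ) ≤
        contactDeficiency ((X \ P₁) \ P₂) +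
          (Real.sqrt 2 / 4 * ∑ᶠ w ∈ {w ∈ fccStacking 1 (Real.sqrt (2 / 3)) | ‖w‖ = 1},
              |⟪w, A₁.symm (EuclideanSpace.single (2 : Fin 3) (1 : ℝ))⟫_ℝ| +
            Real.sqrt 2 / 4 * ∑ᶠ w ∈ {w ∈ fccStacking 1 (Real.sqrt (2 / 3)) | ‖w‖ = 1},
              |⟪w, A₂.symm (EuclideanSpace.single (2 : Fin 3) (1 : ℝ))⟫_ℝ| -
            (1 / 2 : ℝ) * Real.sqrt (1 - ⟪L (EuclideanSpace.single (2 : Fin 3) (1 : ℝ)),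
              (EuclideanSpace.single (2 : Fin 3) (1 : ℝ))⟫_ℝ ^ 2)) * Real.pi * ρ ^ 2 +
          C * (1 + h) * ρ :=
  ⟨L, s₁, s₂, σ, σ', hσ, hσ', hsub₁, hsub₂, twoSlabLedgerAt_mono hcmp
    (twoSlabLedgerAt_oneSided_of_level_third_wide hs₀ hcert hSP A₁ t₁ A₂ t₂ hu₁ hup hn₁ hmenu₁ hun hΛ h3 hnot)⟩

end Summit.Ventures.Crystal3D.Theorems

end
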